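import Summits.ResolutionOfSingularities.ResolutionOfSingularities.Theorems.HilbertSamuelEliminationSigmaMaxModificationsCorridor3WLadderSegmentsBirth
import HarnessLib

/-!
# [OURS · L1 W4.2] THE FIRST BIRTH OF A UNIT: the near locus right after blowing up the (isolated) base point lies in `ℙ(Dir)`, hence is
# `ℙ(Dir)` (an infinite regular irreducible curve) or a finite set of closed points — (Dich⁺)/(RegN) at the chain stage `b + 1`
# (crux `SigmaMaxModifications` stmt-ResolutionOfSingularities-18506; conjunct `SigmaMaxModificationsCorridor3` stmt-…-19249; line `w_ladder`; RECOGNITION assembly, Step A)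

Stub worker res-L1-w42-stub-1 (gen 4). Helper file `--supports stmt-ResolutionOfSingularities-19249 --as helper`; kernel only, no new definition. Printed
facts as binders: `Thm314_point_locus` (through stub-2's `nearLocus_one_subset_projDir`); P-a is DISCHARGED (`ProjDir_projLine_holds`). Read on the
uncompressed localised tower `Seg.unitTowerL b 0` (no (H-emp) needed), transferred to the chain by stub-2's `…_of_localize` lemmas; infinitude of
`ℙ(Dir)` at the chain level by the JACOBSON property of the finite-type stage (a closed irreducible set with a non-closed point is infinite).

* `Seg.infinite_of_isIrreducible_of_not_isClosed` (Jacobson), `Seg.finite_of_forall_isClosed_singleton` (Noetherian sober), `Seg.unitTowerL_C_zero`,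
  **`Seg.dichPlus_regN_birth_zero`** — (Dich⁺) ∧ (RegN) at the chain stage `relIdxL b 0 1` (`= 1`).

OURS bookkeeping; NOT a statement of the manuscript [Hironaka2017] nor of [CossartJannsenSaito2020]. AI-written; AI review is weaker than expert review.

References: V. Cossart, U. Jannsen, S. Saito, LNM 2270 (2020), Thm. 3.14, Lemma 6.33, Def. 6.34 (i), p. 103–105 [CossartJannsenSaito2020].
-/

noncomputable section

set_option linter.dupNamespace false -- namespace `…Corridor3.Moving` re-enters `…Corridor3` (module convention of the Moving files)

open CategoryTheory AlgebraicGeometry TopologicalSpace Topology IsLocalRing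
open Literature.AlgebraicGeometry.Resolution Literature.RingTheory.HilbertSamuel
open Literature.AlgebraicGeometry.CossartJannsenSaito2020
open Summit.ResolutionOfSingularities.ResolutionOfSingularities.Theorems.CampaignW42
open Summit.ResolutionOfSingularities.ResolutionOfSingularities.Theorems.SigmaMaxModificationsCorridor3.Helpers

namespace Summit.ResolutionOfSingularities.ResolutionOfSingularities.Theorems.SigmaMaxModificationsCorridor3.Moving.Seg

/-! ## §1. Two finiteness facts -/

/-- **In a Jacobson space, a closed irreducible set with a non-closed point is infinite** (closed points are dense in closed sets; a finite set of
closed points is closed). [folklore] -/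
theorem infinite_of_isIrreducible_of_not_isClosed {α : Type*} [TopologicalSpace α] [JacobsonSpace α] {Z : Set α} (hZcl : IsClosed Z)
    {η : α} (hη : η ∈ Z) (hηcl : ¬ IsClosed ({η} : Set α)) : Z.Infinite := by
  intro hfin
  have hdense := closure_inter_closedPoints hZcl
  have hcl : IsClosed (Z ∩ closedPoints α) := by
    have : Z ∩ closedPoints α = ⋃ z ∈ Z ∩ closedPoints α, {z} := (Set.biUnion_of_singleton _).symm
    rw [this]
    exact (hfin.subset Set.inter_subset_left).isClosed_biUnion fun z hz => hz.2
  rw [hcl.closure_eq] at hdense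
  have : η ∈ Z ∩ closedPoints α := hdense.symm ▸ hη
  exact hηcl this.2

/-- **In a Noetherian sober space, a closed set all of whose points are closed is finite** (each irreducible component is the closure of its
generic point, a closed point). [folklore] -/
theorem finite_of_forall_isClosed_singleton {W : Scheme.{0}} [NoetherianSpace W] {Z : Set W} (hZ : IsClosed Z)
    (hcl : ∀ z ∈ Z, IsClosed ({z} : Set W)) : Z.Finite := by
  have hcov : Z ⊆ ⋃ E ∈ componentsIn Z, E := fun z hz => by
    obtain ⟨E, hE, hzE⟩ := componentsIn.exists_mem hz
    exact Set.mem_biUnion hE hzE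
  refine ((componentsIn.finite Z).biUnion fun E hE => ?_).subset hcov
  have hirr := componentsIn.isIrreducible hE
  have hEcl := componentsIn.isClosed hZ hE
  have hgen := hirr.isGenericPoint_genericPoint hEcl
  have hE1 : E = {hirr.genericPoint} := hgen.def.symm.trans (hcl _ (componentsIn.subset hE hgen.mem)).closure_eq
  rw [hE1]; exact Set.finite_singleton _

/-! ## §2. The first birth -/

section Birth

variable {R : ∀ S : Scheme.{0}, CentreSeq S → Prop} {N : ℕ} {ν : ℕ → ℕ} {k : Type} [Field k]
  {c : ℕ → MarkedStage.{0}} (hc : ∀ n, CanonicalNearStep R N ν (c n) (c (n + 1))) (hRf : OracleFunctional R) (hRa : OracleAdmissible R)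
  (hν : ν ≠ iterPSum N Phi) (h0 : Helpers.CycleInv k N ν (c 0)) (hgen : ∀ n, ∃ m, n ≤ m ∧ (c m).IsBlownUp R N ν)
  {p : ℕ} {X : Scheme.{0}} [IsLocallyNoetherian X] {x : X} (hX : IsMaximalOrigin p N ν X x)
  (hreach : Reaches R N ν (MarkedStage.init X x) (c 0))

include hRf hX hreach in
/-- `C_0 = {𝔪_{x_b}}` on the partially compressed tower at a blown-up, stratum-isolated base. [cite: CossartJannsenSaito2020, Def. 6.38 (ii)] -/
theorem unitTowerL_C_zero (b L : ℕ)
    (hempL : ∀ n, n < Seg.relIdx hgen b L → ¬ (c (b + n)).IsBlownUp R N ν → (locTower hc hRa hν h0 b).C n = ∅)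
    (hb : (c b).IsBlownUp R N ν) (hU : ∃ U : Set (c b).W, IsOpen U ∧ (c b).pt ∈ U ∧ U ∩ Scheme.hsStratum (c b).W N ν ⊆ {(c b).pt}) :
    (unitTowerL hc hRa hν h0 hgen b L hempL).C 0 = {basePt hc hRa hν h0 b} := by
  obtain ⟨P', hst⟩ := Helpers.isCanonicalStep_chainCentre (shiftStep hc b) 0
  have hmem : (c b).pt ∈ ((Helpers.chainCentre (shiftStep hc b) 0).support : Set (c b).W) :=
    (pt_mem_upTower_C_iff hc hRa hν h0 hRf b 0).mpr hb
  have hmax : stalkIdeal (Helpers.chainCentre (shiftStep hc b) 0) (c b).pt = maximalIdeal ((c b).W.presheaf.stalk (c b).pt) :=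
    hX.stalkIdeal_centre_eq_maximalIdeal_of_stratumIsolated hRa hν (reaches_chain hreach hc b) hU hst hmem
  show ((c b).W.fromSpecStalk (c b).pt).base ⁻¹' ((Helpers.chainCentre (shiftStep hc b) 0).support : Set (c b).W) = _
  ext s
  refine (fromSpecStalk_mem_support_iff_stalkIdeal_le (Helpers.chainCentre (shiftStep hc b) 0) s).trans ?_
  rw [hmax]
  constructor
  · intro h
    exact PrimeSpectrum.ext ((maximalIdeal.isMaximal _).eq_of_le s.2.ne_top h).symm
  · intro h
    rw [Set.mem_singleton_iff.mp h]
    exact le_rfl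

include hRf hX hreach in
/-- **THE FIRST BIRTH.** At a blown-up isolated base `b` with `e_{x_b} = 2`, in the (F1) range: (Dich⁺) and (RegN) at the chain stage right after the base
(index `relIdxL b 0 1`), modulo the printed point-locus form of Thm. 3.14. [cite: CossartJannsenSaito2020, Thm. 3.14, Def. 6.34 (i), p. 103–105] -/
theorem dichPlus_regN_birth_zero (h314pt : Thm314_point_locus.{0}) (b : ℕ) (hb : (c b).IsBlownUp R N ν) (hiso : Iso N (c b))
    (hchar : CharHypothesis (c b).W (c b).pt) (he : dirDim (c b) = 2) :
    ((((upTower hc hRa hν h0 b).nearLocus N (c b).pt (Seg.relIdxL hgen b 0 1)).Infinite ∧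
        IsIrreducible ((upTower hc hRa hν h0 b).nearLocus N (c b).pt (Seg.relIdxL hgen b 0 1)) ∧
        ∀ y ∈ (upTower hc hRa hν h0 b).nearLocus N (c b).pt (Seg.relIdxL hgen b 0 1),
          ¬ IsGenericPoint y ((upTower hc hRa hν h0 b).nearLocus N (c b).pt (Seg.relIdxL hgen b 0 1)) →
            IsClosed ({y} : Set (c (b + Seg.relIdxL hgen b 0 1)).W)) ∨
      (((upTower hc hRa hν h0 b).nearLocus N (c b).pt (Seg.relIdxL hgen b 0 1)).Finite ∧
        ∀ y ∈ (upTower hc hRa hν h0 b).nearLocus N (c b).pt (Seg.relIdxL hgen b 0 1),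
          IsClosed ({y} : Set (c (b + Seg.relIdxL hgen b 0 1)).W))) ∧
    (((upTower hc hRa hν h0 b).nearLocus N (c b).pt (Seg.relIdxL hgen b 0 1)).Infinite →
      ∀ h : IsClosed ((upTower hc hRa hν h0 b).nearLocus N (c b).pt (Seg.relIdxL hgen b 0 1)),
        Scheme.IsRegular (Scheme.IdealSheafData.vanishingIdeal ⟨(upTower hc hRa hν h0 b).nearLocus N (c b).pt (Seg.relIdxL hgen b 0 1), h⟩).subscheme) := by
  haveI : IsLocallyNoetherian ((upTower hc hRa hν h0 b).X 0) := (upTower hc hRa hν h0 b).ln 0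
  haveI : IsLocallyNoetherian (c b).W := (c b).ln
  haveI := flat_fromSpecStalk ((upTower hc hRa hν h0 b).X 0) ((c b).pt : (upTower hc hRa hν h0 b).X 0)
  obtain ⟨k', _, _, hg⟩ := hX.exists_stateGood_of_reaches hRa hν (reaches_chain hreach hc b)
  have hU := stratumIsolated_of_iso hg hiso
  have hempL : ∀ n, n < Seg.relIdx hgen b 0 → ¬ (c (b + n)).IsBlownUp R N ν → (locTower hc hRa hν h0 b).C n = ∅ :=
    fun n hn => absurd hn (Nat.not_lt_zero n)
  -- data of the localised tower `T = unitTowerL b 0`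
  have hkey := keySetting_unitTowerL hc hRa hν h0 hgen hempL (N := N)
  have hperm := isPermissible_centreIdeal_unitTowerL hc hRa hν h0 hgen hempL (N := N)
  have hx : IsClosed ({basePt hc hRa hν h0 b} : Set ((unitTowerL hc hRa hν h0 hgen b 0 hempL).X 0)) := isClosed_singleton_closedPoint _
  have hC0 := unitTowerL_C_zero hc hRf hRa hν h0 hgen hX hreach b 0 hempL hb hU
  have heT : (unitTowerL hc hRa hν h0 hgen b 0 hempL).dirDimAt 0 (basePt hc hRa hν h0 b) = 2 :=
    (Scheme.dirDim_fromSpecStalk_closedPoint (c b).W (c b).pt).trans he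
  have hsub := BlowupTowerNear.nearLocus_one_subset_projDir (T := unitTowerL hc hRa hν h0 hgen b 0 hempL) h314pt hkey hperm hx hC0
    (charHypothesis_unitTowerL hc hRa hν h0 hgen hempL hchar)
  obtain ⟨hKcl, hKirr, hKnt, hKpts⟩ := BlowupTowerNear.curveData_projDir (T := unitTowerL hc hRa hν h0 hgen b 0 hempL) ProjDir_projLine_holds hx hC0 heT
  -- the projective line facts of P-a: generic point not closed, regular reduced structure
  have hbl : IsBlowup ((unitTowerL hc hRa hν h0 hgen b 0 hempL).π 0)
      (Scheme.IdealSheafData.vanishingIdeal ⟨{basePt hc hRa hν h0 b}, hx⟩) := by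
    have h := (unitTowerL hc hRa hν h0 hgen b 0 hempL).isBlowup 0
    have hcl : (⟨(unitTowerL hc hRa hν h0 hgen b 0 hempL).C 0, (unitTowerL hc hRa hν h0 hgen b 0 hempL).isClosed_C 0⟩ :
        Closeds ((unitTowerL hc hRa hν h0 hgen b 0 hempL).X 0)) = ⟨{basePt hc hRa hν h0 b}, hx⟩ := Closeds.ext hC0
    rwa [hcl] at h
  haveI : IsLocallyNoetherian ((unitTowerL hc hRa hν h0 hgen b 0 hempL).X 0) := (unitTowerL hc hRa hν h0 hgen b 0 hempL).ln 0
  obtain ⟨-, -, hKgen, -, hKreg⟩ := ProjDir_projLine_holds ((unitTowerL hc hRa hν h0 hgen b 0 hempL).X 0) ((unitTowerL hc hRa hν h0 hgen b 0 hempL).X 1)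
    ((unitTowerL hc hRa hν h0 hgen b 0 hempL).π 0) (basePt hc hRa hν h0 b) hx hbl heT
  -- abbreviations
  have hNeq' := nearLocus_unitTowerL hc hRa hν h0 hgen hempL (b := b) (L := 0) 1
  have hNcl : IsClosed ((upTower hc hRa hν h0 b).nearLocus N (c b).pt (Seg.relIdxL hgen b 0 1)) := isClosed_nearLocus hc hRa hν h0 hX hreach b _
  have hNTcl : IsClosed ((unitTowerL hc hRa hν h0 hgen b 0 hempL).nearLocus N (basePt hc hRa hν h0 b) 1) := by
    rw [hNeq']; exact hNcl.preimage (locι hc hRa hν h0 b _).continuous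
  have hrange : (upTower hc hRa hν h0 b).nearLocus N (c b).pt (Seg.relIdxL hgen b 0 1) ⊆ Set.range (locι hc hRa hν h0 b (Seg.relIdxL hgen b 0 1)).base := by
    have h := BlowupTowerNear.nearLocus_subset_range_bcι (upTower hc hRa hν h0 b)
      (((upTower hc hRa hν h0 b).X 0).fromSpecStalk ((c b).pt : (upTower hc hRa hν h0 b).X 0)) N (basePt hc hRa hν h0 b) (Seg.relIdxL hgen b 0 1)
    rw [show (((upTower hc hRa hν h0 b).X 0).fromSpecStalk ((c b).pt : (upTower hc hRa hν h0 b).X 0)).base (basePt hc hRa hν h0 b) = (c b).pt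
      from Scheme.fromSpecStalk_closedPoint] at h
    exact h
  have hemb : Topology.IsEmbedding (locι hc hRa hν h0 b (Seg.relIdxL hgen b 0 1)).base :=
    @Scheme.Hom.isEmbedding _ _ (locι hc hRa hν h0 b (Seg.relIdxL hgen b 0 1))
      ((upTower hc hRa hν h0 b).isPreimmersion_bcι (((upTower hc hRa hν h0 b).X 0).fromSpecStalk ((c b).pt : (upTower hc hRa hν h0 b).X 0)) _)
  have hsurj : (locι hc hRa hν h0 b (Seg.relIdxL hgen b 0 1)).base '' ((locι hc hRa hν h0 b (Seg.relIdxL hgen b 0 1)).base ⁻¹'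
      (upTower hc hRa hν h0 b).nearLocus N (c b).pt (Seg.relIdxL hgen b 0 1)) = (upTower hc hRa hν h0 b).nearLocus N (c b).pt (Seg.relIdxL hgen b 0 1) :=
    Set.image_preimage_eq_of_subset hrange
  have hxb : IsClosed ({(((upTower hc hRa hν h0 b).X 0).fromSpecStalk ((c b).pt : (upTower hc hRa hν h0 b).X 0)).base (basePt hc hRa hν h0 b)} :
      Set ((upTower hc hRa hν h0 b).X 0)) := by
    rw [show (((upTower hc hRa hν h0 b).X 0).fromSpecStalk ((c b).pt : (upTower hc hRa hν h0 b).X 0)).base (basePt hc hRa hν h0 b) = (c b).pt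
      from Scheme.fromSpecStalk_closedPoint]
    exact Reaches.isClosed_pt hX.isClosed (reaches_chain hreach hc b)
  have hNeq : (unitTowerL hc hRa hν h0 hgen b 0 hempL).nearLocus N (basePt hc hRa hν h0 b) 1 =
      (locTower hc hRa hν h0 b).nearLocus N (basePt hc hRa hν h0 b) (Seg.relIdxL hgen b 0 1) :=
    (locTower hc hRa hν h0 b).nearLocus_compress_zero (htriv_of_hEmpL hc hRa hν h0 hgen hempL) N (basePt hc hRa hν h0 b) 1
  have hclUp : ∀ s ∈ (unitTowerL hc hRa hν h0 hgen b 0 hempL).nearLocus N (basePt hc hRa hν h0 b) 1,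
      IsClosed ({s} : Set ((unitTowerL hc hRa hν h0 hgen b 0 hempL).X 1)) →
      IsClosed ({(locι hc hRa hν h0 b (Seg.relIdxL hgen b 0 1)).base s} : Set (c (b + Seg.relIdxL hgen b 0 1)).W) := by
    intro s hs hscl
    rw [hNeq] at hs
    exact BlowupTowerNear.isClosed_singleton_bcι_of_phi_eq (upTower hc hRa hν h0 b)
      (((upTower hc hRa hν h0 b).X 0).fromSpecStalk ((c b).pt : (upTower hc hRa hν h0 b).X 0)) (basePt hc hRa hν h0 b) _ hxb hs.1 hscl
  -- Noetherian / Jacobson chain stage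
  have hcyc : Helpers.CycleInv k N ν (c (b + Seg.relIdxL hgen b 0 1)) := cycleInv_at hc hRa hν h0 _
  obtain ⟨f, hft, hqc⟩ := hcyc.1
  haveI := hft; haveI := hqc
  haveI : IsNoetherian (c (b + Seg.relIdxL hgen b 0 1)).W := Scheme.isNoetherian_of_finiteType_over_field f
  haveI : NoetherianSpace ((upTower hc hRa hν h0 b).X (Seg.relIdxL hgen b 0 1)) :=
    IsNoetherian.noetherianSpace (X := (c (b + Seg.relIdxL hgen b 0 1)).W)
  haveI : JacobsonSpace ((upTower hc hRa hν h0 b).X (Seg.relIdxL hgen b 0 1)) := LocallyOfFiniteType.jacobsonSpace (X := (c (b + Seg.relIdxL hgen b 0 1)).W) f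
  by_cases hηN : hKirr.genericPoint ∈ (unitTowerL hc hRa hν h0 hgen b 0 hempL).nearLocus N (basePt hc hRa hν h0 b) 1
  · -- dominant: `N_1 = ℙ(Dir)`
    have hηK := hKirr.isGenericPoint_genericPoint hKcl
    have hNK : (unitTowerL hc hRa hν h0 hgen b 0 hempL).nearLocus N (basePt hc hRa hν h0 b) 1 =
        (unitTowerL hc hRa hν h0 hgen b 0 hempL).projDir (basePt hc hRa hν h0 b) := by
      refine Set.Subset.antisymm hsub ?_
      rw [← hηK.def]
      exact closure_minimal (Set.singleton_subset_iff.mpr hηN) hNTcl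
    -- irreducible / curve data / a non-closed point, transferred up
    have hirrUp : IsIrreducible ((upTower hc hRa hν h0 b).nearLocus N (c b).pt (Seg.relIdxL hgen b 0 1)) := by
      have h1 : IsIrreducible ((locι hc hRa hν h0 b (Seg.relIdxL hgen b 0 1)).base ⁻¹' (upTower hc hRa hν h0 b).nearLocus N (c b).pt (Seg.relIdxL hgen b 0 1)) := by
        rw [← hNeq', hNK]; exact hKirr
      have := h1.image _ (locι hc hRa hν h0 b _).continuous.continuousOn
      rwa [hsurj] at this
    have hηncl : ¬ IsClosed ({hKirr.genericPoint} : Set ((unitTowerL hc hRa hν h0 hgen b 0 hempL).X 1)) := hKgen _ hηK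
    have hne : ∃ z ∈ (upTower hc hRa hν h0 b).nearLocus N (c b).pt (Seg.relIdxL hgen b 0 1), ¬ IsClosed ({z} : Set (c (b + Seg.relIdxL hgen b 0 1)).W) := by
      have h := BlowupTowerNear.exists_not_isClosed_singleton_nearLocus_of_baseChange (upTower hc hRa hν h0 b)
        (((upTower hc hRa hν h0 b).X 0).fromSpecStalk ((c b).pt : (upTower hc hRa hν h0 b).X 0)) N (basePt hc hRa hν h0 b) (Seg.relIdxL hgen b 0 1)
        ⟨hKirr.genericPoint, hNeq ▸ hηN, hηncl⟩
      rw [show (((upTower hc hRa hν h0 b).X 0).fromSpecStalk ((c b).pt : (upTower hc hRa hν h0 b).X 0)).base (basePt hc hRa hν h0 b) = (c b).pt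
        from Scheme.fromSpecStalk_closedPoint] at h
      exact h
    have hinfUp : ((upTower hc hRa hν h0 b).nearLocus N (c b).pt (Seg.relIdxL hgen b 0 1)).Infinite := by
      obtain ⟨z, hz, hzcl⟩ := hne
      exact infinite_of_isIrreducible_of_not_isClosed hNcl hz hzcl
    refine ⟨Or.inl ⟨hinfUp, hirrUp, fun y hy hng => ?_⟩, fun _ h' => ?_⟩
    · obtain ⟨s, hs, rfl⟩ := hsurj.symm.subset hy
      have hs' : s ∈ (unitTowerL hc hRa hν h0 hgen b 0 hempL).nearLocus N (basePt hc hRa hν h0 b) 1 := by rw [hNeq']; exact hs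
      refine hclUp s hs' (hKpts s (hNK ▸ hs') fun hgs => hng ?_)
      have hgs' : IsGenericPoint s ((locι hc hRa hν h0 b (Seg.relIdxL hgen b 0 1)).base ⁻¹'
          (upTower hc hRa hν h0 b).nearLocus N (c b).pt (Seg.relIdxL hgen b 0 1)) := by rw [← hNeq', hNK]; exact hgs
      exact (isGenericPoint_iff_of_isEmbedding hemb hNcl hsurj hs).mp hgs'
    · -- regularity: `V_red(N^T_1) = V_red(ℙ(Dir))` is regular by P-a, then transfer up
      have hS' : IsClosed ((locTower hc hRa hν h0 b).nearLocus N (basePt hc hRa hν h0 b) (Seg.relIdxL hgen b 0 1)) := by rw [← hNeq]; exact hNTcl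
      have hregT : Scheme.IsRegular (Scheme.IdealSheafData.vanishingIdeal
          (⟨(locTower hc hRa hν h0 b).nearLocus N (basePt hc hRa hν h0 b) (Seg.relIdxL hgen b 0 1), hS'⟩ :
            Closeds ((locTower hc hRa hν h0 b).X (Seg.relIdxL hgen b 0 1)))).subscheme := by
        have e : (⟨(unitTowerL hc hRa hν h0 hgen b 0 hempL).projDir (basePt hc hRa hν h0 b), hKcl⟩ :
            Closeds ((locTower hc hRa hν h0 b).X (Seg.relIdxL hgen b 0 1))) =
            ⟨(locTower hc hRa hν h0 b).nearLocus N (basePt hc hRa hν h0 b) (Seg.relIdxL hgen b 0 1), hS'⟩ := Closeds.ext (hNK.symm.trans hNeq)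
        rw [← e]
        intro y
        have hy : (Scheme.IdealSheafData.vanishingIdeal (⟨(unitTowerL hc hRa hν h0 hgen b 0 hempL).projDir (basePt hc hRa hν h0 b), hKcl⟩ :
            Closeds ((locTower hc hRa hν h0 b).X (Seg.relIdxL hgen b 0 1)))).subschemeι.base y ∈ (unitTowerL hc hRa hν h0 hgen b 0 hempL).projDir (basePt hc hRa hν h0 b) := by
          have := Set.mem_range_self (f := (Scheme.IdealSheafData.vanishingIdeal (⟨(unitTowerL hc hRa hν h0 hgen b 0 hempL).projDir (basePt hc hRa hν h0 b), hKcl⟩ :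
            Closeds ((locTower hc hRa hν h0 b).X (Seg.relIdxL hgen b 0 1)))).subschemeι.base) y
          rw [Scheme.IdealSheafData.range_subschemeι, Scheme.IdealSheafData.coe_support_vanishingIdeal] at this
          exact this
        exact (isRegularLocalRing_stalk_subscheme_iff _ y).mpr (hKreg hKcl _ hy).1
      exact BlowupTowerNear.isRegular_nearLocus_of_localize (upTower hc hRa hν h0 b) N (c b).pt _ hS' h' hregT
  · -- not dominant: all points of `N_1` are closed, hence `N_1` is finite
    have hclT : ∀ s ∈ (unitTowerL hc hRa hν h0 hgen b 0 hempL).nearLocus N (basePt hc hRa hν h0 b) 1,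
        IsClosed ({s} : Set ((unitTowerL hc hRa hν h0 hgen b 0 hempL).X 1)) := fun s hs =>
      hKpts s (hsub hs) fun hgen => hηN ((hgen.eq (hKirr.isGenericPoint_genericPoint hKcl)) ▸ hs)
    have hclUp' : ∀ y ∈ (upTower hc hRa hν h0 b).nearLocus N (c b).pt (Seg.relIdxL hgen b 0 1), IsClosed ({y} : Set (c (b + Seg.relIdxL hgen b 0 1)).W) := by
      intro y hy
      obtain ⟨s, hs, rfl⟩ := hsurj.symm.subset hy
      have hs' : s ∈ (unitTowerL hc hRa hν h0 hgen b 0 hempL).nearLocus N (basePt hc hRa hν h0 b) 1 := by rw [hNeq']; exact hs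
      exact hclUp s hs' (hclT s hs')
    have hfin := finite_of_forall_isClosed_singleton hNcl hclUp'
    exact ⟨Or.inr ⟨hfin, hclUp'⟩, fun hinf => absurd hfin hinf⟩

end Birth

end Summit.ResolutionOfSingularities.ResolutionOfSingularities.Theorems.SigmaMaxModificationsCorridor3.Moving.Seg

end
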